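import Summits.FinalStateConjecture.FinalStateConjecture.Theorems.SwallowTheDatumParametricKerrBurialReduction
import Summits.FinalStateConjecture.FinalStateConjecture.Theorems.SwallowTheDatumBurialIntoShieldedBackground

/-!
# Route `SwallowTheDatum` · item `BurialIntoShieldedBackground` (stmt-FinalStateConjecture-14721) —
# the item's residual debt is the crux's: far gluing (A) and the RELATIVE universal collar (B′)

The item reads `KerrShieldedDataExist → ParametricKerrBurial`.  The crux `ParametricKerrBurial`
(stmt-FinalStateConjecture-10052) is reduced in the tree to exactly two registered statements
(`ParametricKerrBurial.ParametricKerrBurial_of_farGluing_of_collarDatum`,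
`Theorems/SwallowTheDatumParametricKerrBurialReduction.lean`):

* (A) `stub_farGluing` — receding obstruction-free annular gluing of the admissible datum onto a growing exact
  isotropic Schwarzschild seed, smooth in the radius (Mao–Oh–Tao arXiv:2308.13031 Thm 1.7/1.10);
* (B) `stub_collarDatum` — one admissible vacuum datum on `ℝ³`, exactly isotropic Schwarzschild(`μ`), `k = 0`, on
  `{1 < ‖y‖ < 2}`, Kerr-shielded beyond radius `2`.

This file records, sorry-free, what the item's OWN hypothesis buys against that reduction:

* `kerrShieldedDataExist_of_collarDatum` : (B) ⇒ `KerrShieldedDataExist` (a located shield is a shield; the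
  hard-coded height of the route decl is `bentHeight` by `rfl`), so (B) is the item's hypothesis PLUS a vacuum mass
  jump `μ → M` below the shield;
* `of_farGluing_of_relativeCollar` : (A) ⇒ (`KerrShieldedDataExist` → (B)) ⇒ item — under the item's hypothesis the
  collar debt weakens to the RELATIVE collar B′ := `KerrShieldedDataExist → stub_collarDatum` ("from one shielded
  admissible datum make one with a Schwarzschild(`μ`) throat annulus below the shield");
* `of_farGluing_of_collarDatum` : (A) ⇒ (B) ⇒ item (weakening of the previous);
* `iff_parametricKerrBurial`, `iff_parametricKerrBurial_of_collarDatum` : under `KerrShieldedDataExist` (in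
  particular under (B)) the item and the crux are EQUIVALENT.

Why nothing sharper is claimed (release note of the item, 2026-08-16): the witness `B₀` of `KerrShieldedDataExist`
is usable by a burial proof only through a pocket of its core that is free of local Killing initial data (Hintz
arXiv:2210.13960 Thm 1.1 needs "no KIDs in `U°`"; obstruction-free annular gluing into a near-flat pocket is
sign-obstructed, Mao–Oh–Tao Rem 1.11), and the typed hypothesis certifies no such pocket (Li–Mei's witness has a
FLAT core ball — all ten KIDs — and an uncertified pulse zone); a proof that discards the core uses only the exact
Kerr shell `{r > r₁}`, i.e. does not use the hypothesis at all.  Hence B′ is not known to be easier than (B), and the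
item closes exactly when the crux does (`BurialIntoShieldedBackground.of_parametricKerrBurial`).

References: route file `Theses/SwallowTheDatum.lean` rev 8 (items 14721, 10052, 10055); Mao–Oh–Tao arXiv:2308.13031
Thm 1.7, Rem 1.11; Hintz arXiv:2210.13960 Thm 1.1; Li–Mei arXiv:2005.01249 §2.2; Beig–Chruściel–Schoen
arXiv:gr-qc/0403042.
-/

-- `Summit.<Summit>.<Problem>`: single-conjunct summit, the duplicate namespace component is mandated (CONVENTIONS §2).
set_option linter.dupNamespace false

noncomputable section

namespace Summit.FinalStateConjecture.FinalStateConjecture.Theorems.SwallowTheDatum.BurialIntoShieldedBackground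

open scoped Manifold ContDiff Topology
open Bundle Set Function Literature.Geometry.Lorentzian
open Summit.FinalStateConjecture.FinalStateConjecture.Theses.SwallowTheDatum
  (ParametricKerrBurial KerrShieldedDataExist BurialIntoShieldedBackground)
open Summit.FinalStateConjecture.FinalStateConjecture.Theorems.SwallowTheDatum.ParametricKerrBurial
  (IsKerrShielded IsKerrShieldedAway IsSchwarzschildAnnulus IsExactSchwarzschildBeyond SmoothSectionsOn AgreeAt
    ParametricKerrBurial_of_farGluing_of_collarDatum)

/-- **(B) ⇒ the item's hypothesis.** The universal collar datum of the crux line (registered stub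
`stub_collarDatum`, signature verbatim) is in particular an admissible Kerr-shielded datum on `ℝ³`: instantiate
`μ₀ = 1`, forget the Schwarzschild annulus and the location of the shield (`IsKerrShieldedAway.isKerrShielded`);
the route decl `KerrShieldedDataExist` is this up to `Iff.rfl` (`kerrShieldedDataExist_iff`). [folklore] -/
theorem kerrShieldedDataExist_of_collarDatum
    (hB : ∀ [Kerr.Facts], ∀ μ₀ : ℝ, 0 < μ₀ → ∃ μ : ℝ, 0 < μ ∧ μ ≤ μ₀ ∧
      ∃ C ∈ admissibleVacuumData E3, IsSchwarzschildAnnulus C μ ∧ IsKerrShieldedAway 2 C) :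
    KerrShieldedDataExist := by
  rw [kerrShieldedDataExist_iff]
  intro _
  obtain ⟨-, -, -, C, hC, -, hS⟩ := hB 1 one_pos
  exact ⟨C, hC, hS.isKerrShielded⟩

/-- **The item from far gluing (A) and the RELATIVE collar (B′).**  If every admissible datum admits the receding
far-gluing family of `stub_farGluing` (hypothesis `hA`, signature verbatim) and ONE admissible Kerr-shielded datum on
`ℝ³` yields the universal collar datum of `stub_collarDatum` (hypothesis `hB'` = `KerrShieldedDataExist →` the
registered signature verbatim), then `BurialIntoShieldedBackground` holds: feed the background through `hB'` and
apply the crux line's landed reduction `ParametricKerrBurial_of_farGluing_of_collarDatum` (junction p74984, collar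
dilation p84287, transport-and-patch p91483, breathing p86339, composition p92199). [folklore] -/
theorem of_farGluing_of_relativeCollar
    (hA : ∀ (X : Type) [TopologicalSpace X] [ChartedSpace E3 X] [IsManifold (𝓡 3) ∞ X] [T2Space X]
      [SecondCountableTopology X] [ConnectedSpace X], ∀ d ∈ admissibleVacuumData X,
      ∃ (η : ℝ) (e : AFEnd X) (Rstar : ℝ) (m : ℝ → ℝ) (G : ℝ → InitialDataSet (𝓡 3) X),
        0 < η ∧ e.IsSoleEnd ∧ e.R < Rstar ∧ ContDiff ℝ ∞ m ∧
        SmoothSectionsOn 𝓘(ℝ, ℝ) G {p : ℝ × X | Rstar < p.1} ∧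
        ∀ R : ℝ, Rstar < R → G R ∈ admissibleVacuumData X ∧ (∀ x ∉ e.far R, AgreeAt (G R) d x) ∧
          η * R ≤ m R ∧ IsExactSchwarzschildBeyond e (G R) (m R) (32 * R))
    (hB' : KerrShieldedDataExist →
      ∀ [Kerr.Facts], ∀ μ₀ : ℝ, 0 < μ₀ → ∃ μ : ℝ, 0 < μ ∧ μ ≤ μ₀ ∧
        ∃ C ∈ admissibleVacuumData E3, IsSchwarzschildAnnulus C μ ∧ IsKerrShieldedAway 2 C) :
    BurialIntoShieldedBackground :=
  fun hK ↦ ParametricKerrBurial_of_farGluing_of_collarDatum hA (hB' hK)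

/-- **The item from far gluing (A) and the universal collar (B)** — the crux's two registered open statements
(signatures verbatim) also settle this item (weakening of `of_farGluing_of_relativeCollar`; equivalently
`of_parametricKerrBurial ∘ ParametricKerrBurial_of_farGluing_of_collarDatum`). [folklore] -/
theorem of_farGluing_of_collarDatum
    (hA : ∀ (X : Type) [TopologicalSpace X] [ChartedSpace E3 X] [IsManifold (𝓡 3) ∞ X] [T2Space X]
      [SecondCountableTopology X] [ConnectedSpace X], ∀ d ∈ admissibleVacuumData X,
      ∃ (η : ℝ) (e : AFEnd X) (Rstar : ℝ) (m : ℝ → ℝ) (G : ℝ → InitialDataSet (𝓡 3) X),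
        0 < η ∧ e.IsSoleEnd ∧ e.R < Rstar ∧ ContDiff ℝ ∞ m ∧
        SmoothSectionsOn 𝓘(ℝ, ℝ) G {p : ℝ × X | Rstar < p.1} ∧
        ∀ R : ℝ, Rstar < R → G R ∈ admissibleVacuumData X ∧ (∀ x ∉ e.far R, AgreeAt (G R) d x) ∧
          η * R ≤ m R ∧ IsExactSchwarzschildBeyond e (G R) (m R) (32 * R))
    (hB : ∀ [Kerr.Facts], ∀ μ₀ : ℝ, 0 < μ₀ → ∃ μ : ℝ, 0 < μ ∧ μ ≤ μ₀ ∧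
      ∃ C ∈ admissibleVacuumData E3, IsSchwarzschildAnnulus C μ ∧ IsKerrShieldedAway 2 C) :
    BurialIntoShieldedBackground :=
  of_farGluing_of_relativeCollar hA fun _ ↦ hB

/-- **Under its own hypothesis the item IS the crux**: given `KerrShieldedDataExist`,
`BurialIntoShieldedBackground ↔ ParametricKerrBurial` (modus ponens one way, weakening the other —
`parametricKerrBurial_of`, `of_parametricKerrBurial`). [folklore] -/
theorem iff_parametricKerrBurial (hK : KerrShieldedDataExist) :
    BurialIntoShieldedBackground ↔ ParametricKerrBurial :=
  ⟨fun h ↦ parametricKerrBurial_of h hK, of_parametricKerrBurial⟩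

/-- In particular under the universal collar (B) of the crux line the item and the crux are equivalent, and both
then reduce to far gluing (A) alone. [folklore] -/
theorem iff_parametricKerrBurial_of_collarDatum
    (hB : ∀ [Kerr.Facts], ∀ μ₀ : ℝ, 0 < μ₀ → ∃ μ : ℝ, 0 < μ ∧ μ ≤ μ₀ ∧
      ∃ C ∈ admissibleVacuumData E3, IsSchwarzschildAnnulus C μ ∧ IsKerrShieldedAway 2 C) :
    BurialIntoShieldedBackground ↔ ParametricKerrBurial :=
  iff_parametricKerrBurial (kerrShieldedDataExist_of_collarDatum hB)

end Summit.FinalStateConjecture.FinalStateConjecture.Theorems.SwallowTheDatum.BurialIntoShieldedBackground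

end
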